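import Mathlib
import Summits.AtomisticToContinuum.HydrodynamicLimit.Theorems.ImplosionDichotomyDenseExcursionPackingAnalyticMajorant

/-!
# The majorant lemma for an ANALYTIC nonlinearity (all degrees): geometric growth of the hierarchy of `Γ`
# (crux `DenseExcursion`, stmt-AtomisticToContinuum-12586, line `packing-analytic-implosion`)

Helper file (`--supports stmt-AtomisticToContinuum-12586`, line lead a2, stub `stub_analyticPackingImplosion`).
Sequel of `…PackingAnalyticMajorant.lean` (the QUADRATIC, sub-Catalan case). The hierarchy of the analytic packing
implosion `Γ = SS + Σ_k Gᵏ X_k` has sources of ALL degrees in the lower orders (the stiffening law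
`M(G e^{3x} s³) = Σ_j m_j Gʲ e^{3jx} s^{3j}` is analytic, not polynomial), so the norms `t k = ‖X_k‖` obey, after
the resolvent bound and the algebra property of the norms, a recursion of the shape
`t k ≤ Σ_{m=2}^{k} a_m [Gᵏ] T(G)^m` (`k ≥ 2`), `T(G) = Σ_{i ≥ 1} t i Gⁱ`, with GEOMETRIC coefficients
`0 ≤ a_m ≤ A αᵐ` (explicit powers `Gʲ` are absorbed by `G ≪ T(G)/t₁`). Kernel-checked here, over Mathlib's
`PowerSeries` (`[Gᵏ] T^m = PowerSeries.coeff k (PowerSeries.mk t ^ m)`):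

* `analytic_majorant` (REGISTERED helper): such a sequence grows at most geometrically,
  `t k ≤ t 1 · (t 1 · (16 α + 16 A α² + 1))^{k−1} / k²` for `k ≥ 1` — the discrete form of the majorant method
  (Cauchy–Kovalevskaya / analytic implicit function theorem), proved by the `1/k²`-weight trick:
  `Σ_{i+j=k} 1/(i² j²) ≤ 8/k²` (`sum_inv_sq_conv_le`), whence `[Gᵏ](Σ K Bⁱ/i² · Gⁱ)^m ≤ K^m Bᵏ 8^{m−1}/k²`
  (`coeff_pow_weight_le`) and the induction closes with `K = 1/(16α + 16Aα² + 1)`, `B = t 1 / K`;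
* `summable_of_analytic_majorant`: `Σ t k gᵏ` converges for `|g| · t 1 · (16α + 16Aα² + 1) < 1`.

Pure real analysis / combinatorics over Mathlib (`PowerSeries.coeff_mul`, `hasSum_zeta_two` for `Σ 1/i² ≤ 2`,
`Real.pi_lt_d2`). NOT here: the norms, the resolvent bounds, or the nonlinearity of `Γ` itself (see the report).
-/

noncomputable section

open Finset PowerSeries

namespace Summit.AtomisticToContinuum.HydrodynamicLimit.Theorems.PackingAnalyticImplosion

/-! ## Elementary bounds: `Σ 1/i² ≤ 2` and the two-fold `1/k²` convolution -/

/-- `Σ_{i < n} 1/i² ≤ 2` (the `i = 0` term is `0` in `ℝ`; from `ζ(2) = π²/6`). [folklore] -/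
theorem sum_range_inv_sq_le_two (n : ℕ) : ∑ i ∈ range n, (1 : ℝ) / (i : ℝ) ^ 2 ≤ 2 := by
  have h := sum_le_hasSum (range n) (fun i _ => by positivity) hasSum_zeta_two
  have hπ : Real.pi ^ 2 / 6 ≤ 2 := by
    have h1 := Real.pi_lt_d2
    have h2 := Real.pi_pos
    nlinarith
  exact h.trans hπ

/-- The `1/k²`-weight trick: `Σ_{i=0}^{k} 1/(i² (k−i)²) ≤ 8/k²` (`k ≥ 1`; boundary terms vanish in `ℝ`). [folklore] -/
theorem sum_inv_sq_conv_le (k : ℕ) (hk : 1 ≤ k) :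
    ∑ i ∈ range (k + 1), (1 : ℝ) / ((i : ℝ) ^ 2 * ((k - i : ℕ) : ℝ) ^ 2) ≤ 8 / (k : ℝ) ^ 2 := by
  have hk' : (0 : ℝ) < k := by exact_mod_cast hk
  -- termwise: `1/(i²(k-i)²) ≤ (2/k²)(1/i² + 1/(k-i)²)`
  have hterm : ∀ i ∈ range (k + 1), (1 : ℝ) / ((i : ℝ) ^ 2 * ((k - i : ℕ) : ℝ) ^ 2) ≤
      2 / (k : ℝ) ^ 2 * (1 / (i : ℝ) ^ 2 + 1 / ((k - i : ℕ) : ℝ) ^ 2) := by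
    intro i hi
    have hik : i ≤ k := Nat.lt_succ_iff.mp (mem_range.mp hi)
    rcases Nat.eq_zero_or_pos i with rfl | hi0
    · simp only [Nat.cast_zero, ne_eq, OfNat.ofNat_ne_zero, not_false_eq_true, zero_pow, zero_mul, div_zero,
        Nat.sub_zero, zero_add]
      positivity
    rcases eq_or_lt_of_le hik with rfl | hlt
    · simp only [Nat.sub_self, Nat.cast_zero, ne_eq, OfNat.ofNat_ne_zero, not_false_eq_true, zero_pow, mul_zero,
        div_zero, add_zero]
      positivity
    have ha : (0 : ℝ) < i := by exact_mod_cast hi0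
    have hb : (0 : ℝ) < ((k - i : ℕ) : ℝ) := by
      have : 0 < k - i := Nat.sub_pos_of_lt hlt
      exact_mod_cast this
    have hab : (i : ℝ) + ((k - i : ℕ) : ℝ) = k := by
      rw [Nat.cast_sub hik]; ring
    set b : ℝ := ((k - i : ℕ) : ℝ) with hbdef
    have key : (1 : ℝ) / ((i : ℝ) ^ 2 * b ^ 2) = (1 / (k : ℝ)) ^ 2 * (1 / (i : ℝ) + 1 / b) ^ 2 := by
      rw [← hab]; field_simp; ring
    have hsq : (1 / (i : ℝ) + 1 / b) ^ 2 ≤ 2 * (1 / (i : ℝ) ^ 2 + 1 / b ^ 2) := by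
      have h0 := sq_nonneg (1 / (i : ℝ) - 1 / b)
      have e1 : (1 / (i : ℝ)) ^ 2 = 1 / (i : ℝ) ^ 2 := by rw [one_div_pow]
      have e2 : (1 / b) ^ 2 = 1 / b ^ 2 := by rw [one_div_pow]
      nlinarith
    rw [key]
    calc (1 / (k : ℝ)) ^ 2 * (1 / (i : ℝ) + 1 / b) ^ 2
        ≤ (1 / (k : ℝ)) ^ 2 * (2 * (1 / (i : ℝ) ^ 2 + 1 / b ^ 2)) :=
          mul_le_mul_of_nonneg_left hsq (by positivity)
      _ = 2 / (k : ℝ) ^ 2 * (1 / (i : ℝ) ^ 2 + 1 / b ^ 2) := by rw [one_div_pow]; ring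
  -- the reflected sum equals the direct one
  have hrefl : ∑ i ∈ range (k + 1), (1 : ℝ) / ((k - i : ℕ) : ℝ) ^ 2 = ∑ i ∈ range (k + 1), (1 : ℝ) / (i : ℝ) ^ 2 := by
    have h := sum_range_reflect (fun j => (1 : ℝ) / (j : ℝ) ^ 2) (k + 1)
    simpa using h
  calc ∑ i ∈ range (k + 1), (1 : ℝ) / ((i : ℝ) ^ 2 * ((k - i : ℕ) : ℝ) ^ 2)
      ≤ ∑ i ∈ range (k + 1), 2 / (k : ℝ) ^ 2 * (1 / (i : ℝ) ^ 2 + 1 / ((k - i : ℕ) : ℝ) ^ 2) := sum_le_sum hterm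
    _ = 2 / (k : ℝ) ^ 2 * (∑ i ∈ range (k + 1), (1 : ℝ) / (i : ℝ) ^ 2 +
          ∑ i ∈ range (k + 1), (1 : ℝ) / ((k - i : ℕ) : ℝ) ^ 2) := by rw [← mul_sum, sum_add_distrib]
    _ ≤ 2 / (k : ℝ) ^ 2 * (2 + 2) := by
        rw [hrefl]
        gcongr <;> exact sum_range_inv_sq_le_two _
    _ = 8 / (k : ℝ) ^ 2 := by ring

/-! ## Coefficients of powers of a series with nonnegative coefficients -/

/-- Constant term of a power: `[G⁰] T^m = (t 0)^m`. [folklore] -/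
theorem coeff_zero_mk_pow (t : ℕ → ℝ) (m : ℕ) : coeff 0 ((PowerSeries.mk t) ^ m) = t 0 ^ m := by
  induction m with
  | zero => simp
  | succ m ih => rw [pow_succ, coeff_mul, Nat.antidiagonal_zero, sum_singleton, ih, coeff_mk, pow_succ]

/-- Coefficientwise comparison of powers: if `0 ≤ t i ≤ c i` for `i ≤ j`, then `0 ≤ [Gⁱ] T^m ≤ [Gⁱ] C^m` for
`i ≤ j`. [folklore] -/
theorem coeff_pow_mono {t c : ℕ → ℝ} {j : ℕ} (h : ∀ i, i ≤ j → 0 ≤ t i ∧ t i ≤ c i) :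
    ∀ m i, i ≤ j → 0 ≤ coeff i ((PowerSeries.mk t) ^ m) ∧
      coeff i ((PowerSeries.mk t) ^ m) ≤ coeff i ((PowerSeries.mk c) ^ m) := by
  intro m
  induction m with
  | zero =>
    intro i _
    simp only [pow_zero, coeff_one]
    split_ifs <;> norm_num
  | succ m ih =>
    intro i hi
    rw [pow_succ, pow_succ, coeff_mul, coeff_mul, Nat.sum_antidiagonal_eq_sum_range_succ
      (fun p q => coeff p ((PowerSeries.mk t) ^ m) * coeff q (PowerSeries.mk t)) i,
      Nat.sum_antidiagonal_eq_sum_range_succ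
      (fun p q => coeff p ((PowerSeries.mk c) ^ m) * coeff q (PowerSeries.mk c)) i]
    simp only [coeff_mk]
    have hp : ∀ p ∈ range i.succ, p ≤ j := fun p hp => by
      have := mem_range.mp hp; omega
    constructor
    · exact sum_nonneg fun p hp' => mul_nonneg (ih p (hp p hp')).1 (h _ (by omega)).1
    · refine sum_le_sum fun p hp' => ?_
      have h1 := ih p (hp p hp')
      have h2 := h (i - p) (by omega)
      exact mul_le_mul h1.2 h2.2 h2.1 (h1.1.trans h1.2)

/-- Top-order comparison for powers `m ≥ 2`: `[Gᵏ] T^m ≤ [Gᵏ] C^m` needs `t i ≤ c i` only for `i < k`, because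
with `t 0 = c 0 = 0` the coefficient `[Gᵏ] T^m` does not involve `t k`. [folklore] -/
theorem coeff_pow_mono_top {t c : ℕ → ℝ} {k : ℕ} (ht0 : t 0 = 0) (hc0 : c 0 = 0) (htk : 0 ≤ t k)
    (hck : 0 ≤ c k) (h : ∀ i, i < k → 0 ≤ t i ∧ t i ≤ c i) (m : ℕ) :
    coeff k ((PowerSeries.mk t) ^ (m + 2)) ≤ coeff k ((PowerSeries.mk c) ^ (m + 2)) := by
  rw [pow_succ, pow_succ _ (m + 1), coeff_mul, coeff_mul, Nat.sum_antidiagonal_eq_sum_range_succ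
    (fun p q => coeff p ((PowerSeries.mk t) ^ (m + 1)) * coeff q (PowerSeries.mk t)) k,
    Nat.sum_antidiagonal_eq_sum_range_succ
    (fun p q => coeff p ((PowerSeries.mk c) ^ (m + 1)) * coeff q (PowerSeries.mk c)) k]
  simp only [coeff_mk]
  refine sum_le_sum fun p hp => ?_
  have hpk : p ≤ k := Nat.lt_succ_iff.mp (mem_range.mp hp)
  rcases Nat.eq_zero_or_pos p with rfl | hp0
  · -- `p = 0`: both constant terms vanish
    rw [coeff_zero_mk_pow, coeff_zero_mk_pow, ht0, hc0, zero_pow (Nat.succ_ne_zero m)]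
    simp
  rcases eq_or_lt_of_le hpk with rfl | hlt
  · -- `q = 0`: `t 0 = c 0 = 0`
    simp [ht0, hc0]
  · -- `1 ≤ p < k`, `1 ≤ k - p < k`: the inclusive comparison below `k`
    have hmono := coeff_pow_mono (t := t) (c := c) (j := k - 1) (fun i hi => h i (by omega)) (m + 1) p (by omega)
    have h2 := h (k - p) (by omega)
    exact mul_le_mul hmono.2 h2.2 h2.1 (hmono.1.trans hmono.2)

/-- The weight computation: with `c i = K Bⁱ / i²` (`c 0 = 0` automatically in `ℝ`),
`[Gᵏ] C^{m+1} ≤ K^{m+1} Bᵏ 8^m / k²` for `k ≥ 1`. [folklore] -/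
theorem coeff_pow_weight_le {K B : ℝ} (hK : 0 ≤ K) (hB : 0 ≤ B) :
    ∀ m k, 1 ≤ k → coeff k ((PowerSeries.mk fun i : ℕ => K * B ^ i / (i : ℝ) ^ 2) ^ (m + 1)) ≤
      K ^ (m + 1) * B ^ k * 8 ^ m / (k : ℝ) ^ 2 := by
  intro m
  induction m with
  | zero =>
    intro k _
    simp [coeff_mk]
  | succ m ih =>
    intro k hk
    have hk' : (0 : ℝ) < k := by exact_mod_cast hk
    rw [pow_succ, coeff_mul, Nat.sum_antidiagonal_eq_sum_range_succ
      (fun p q => coeff p ((PowerSeries.mk fun i : ℕ => K * B ^ i / (i : ℝ) ^ 2) ^ (m + 1)) *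
        coeff q (PowerSeries.mk fun i : ℕ => K * B ^ i / (i : ℝ) ^ 2)) k]
    simp only [coeff_mk]
    -- termwise bound by `K^{m+2} B^k 8^m / (p² (k-p)²)`
    have hterm : ∀ p ∈ range k.succ,
        coeff p ((PowerSeries.mk fun i : ℕ => K * B ^ i / (i : ℝ) ^ 2) ^ (m + 1)) *
            (K * B ^ (k - p) / ((k - p : ℕ) : ℝ) ^ 2) ≤
          K ^ (m + 2) * B ^ k * 8 ^ m * (1 / ((p : ℝ) ^ 2 * ((k - p : ℕ) : ℝ) ^ 2)) := by
      intro p hp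
      have hpk : p ≤ k := Nat.lt_succ_iff.mp (mem_range.mp hp)
      rcases Nat.eq_zero_or_pos p with rfl | hp0
      · rw [coeff_zero_mk_pow]
        simp
      have h1 := ih p hp0
      have hq : 0 ≤ K * B ^ (k - p) / ((k - p : ℕ) : ℝ) ^ 2 := by positivity
      calc coeff p ((PowerSeries.mk fun i : ℕ => K * B ^ i / (i : ℝ) ^ 2) ^ (m + 1)) *
            (K * B ^ (k - p) / ((k - p : ℕ) : ℝ) ^ 2)
          ≤ K ^ (m + 1) * B ^ p * 8 ^ m / (p : ℝ) ^ 2 * (K * B ^ (k - p) / ((k - p : ℕ) : ℝ) ^ 2) :=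
            mul_le_mul_of_nonneg_right h1 hq
        _ = K ^ (m + 2) * (B ^ p * B ^ (k - p)) * 8 ^ m * (1 / ((p : ℝ) ^ 2 * ((k - p : ℕ) : ℝ) ^ 2)) := by
            rcases eq_or_ne ((p : ℝ) ^ 2 * ((k - p : ℕ) : ℝ) ^ 2) 0 with h0 | h0
            · have : (p : ℝ) ^ 2 = 0 ∨ ((k - p : ℕ) : ℝ) ^ 2 = 0 := mul_eq_zero.mp h0
              rcases this with h | h <;> simp [h]
            · field_simp
              ring
        _ = K ^ (m + 2) * B ^ k * 8 ^ m * (1 / ((p : ℝ) ^ 2 * ((k - p : ℕ) : ℝ) ^ 2)) := by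
            rw [← pow_add, Nat.add_sub_cancel' hpk]
    calc ∑ p ∈ range k.succ, coeff p ((PowerSeries.mk fun i : ℕ => K * B ^ i / (i : ℝ) ^ 2) ^ (m + 1)) *
            (K * B ^ (k - p) / ((k - p : ℕ) : ℝ) ^ 2)
        ≤ ∑ p ∈ range k.succ, K ^ (m + 2) * B ^ k * 8 ^ m * (1 / ((p : ℝ) ^ 2 * ((k - p : ℕ) : ℝ) ^ 2)) :=
          sum_le_sum hterm
      _ = K ^ (m + 2) * B ^ k * 8 ^ m * ∑ p ∈ range (k + 1), 1 / ((p : ℝ) ^ 2 * ((k - p : ℕ) : ℝ) ^ 2) := by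
          rw [mul_sum]
      _ ≤ K ^ (m + 2) * B ^ k * 8 ^ m * (8 / (k : ℝ) ^ 2) :=
          mul_le_mul_of_nonneg_left (sum_inv_sq_conv_le k hk) (by positivity)
      _ = K ^ (m + 1 + 1) * B ^ k * 8 ^ (m + 1) / (k : ℝ) ^ 2 := by ring

/-! ## The majorant lemma for analytic nonlinearities -/

/-- **THE MAJORANT LEMMA FOR AN ANALYTIC NONLINEARITY** (registered helper `analytic_majorant` of
`stub_analyticPackingImplosion`): a nonnegative sequence `t` with `t 0 = 0` obeying, for `k ≥ 2`,
`t k ≤ Σ_{m=2}^{k} a_m · [Gᵏ] T(G)^m` (`T = Σ t i Gⁱ`, i.e. `[Gᵏ] T^m = PowerSeries.coeff k (PowerSeries.mk t ^ m)`)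
with `0 ≤ a_m ≤ A αᵐ`, grows at most GEOMETRICALLY: `t k ≤ t 1 · (t 1 · (16α + 16Aα² + 1))^{k−1} / k²` for
`k ≥ 1`. The quadratic case `a = (0, 0, C, 0, …)` is the sub-Catalan lemma (`subcatalan_majorant`, sharper
constant there). [folklore] -/
theorem analytic_majorant :
    ∀ (t a : ℕ → ℝ) (A α : ℝ), 0 ≤ A → 0 ≤ α → t 0 = 0 → (∀ k, 0 ≤ t k) → (∀ m, 0 ≤ a m) → (∀ m, a m ≤ A * α ^ m) → (∀ k, 2 ≤ k → t k ≤ ∑ m ∈ Finset.Ico 2 (k + 1), a m * PowerSeries.coeff k (PowerSeries.mk t ^ m)) → ∀ k, 1 ≤ k → t k ≤ t 1 * (t 1 * (16 * α + 16 * A * α ^ 2 + 1)) ^ (k - 1) / (k : ℝ) ^ 2 := by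
  intro t a A α hA hα ht0 ht ha haA hrec
  -- constants
  set L : ℝ := 16 * α + 16 * A * α ^ 2 + 1 with hL
  have hL1 : 1 ≤ L := by rw [hL]; nlinarith [mul_nonneg hA (sq_nonneg α)]
  have hL0 : 0 < L := by linarith
  set K : ℝ := 1 / L with hK
  have hK0 : 0 < K := by rw [hK]; positivity
  have hKL : K * L = 1 := by rw [hK]; field_simp
  have hx : 8 * α * K ≤ 1 / 2 := by
    rw [hK, le_div_iff₀ (by norm_num : (0:ℝ) < 2)]
    rw [show 8 * α * (1 / L) * 2 = 16 * α / L by ring, div_le_one hL0, hL]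
    nlinarith [mul_nonneg hA (sq_nonneg α)]
  have hx0 : 0 ≤ 8 * α * K := by positivity
  have hAK : 16 * A * α ^ 2 * K ≤ 1 := by
    rw [hK, show 16 * A * α ^ 2 * (1 / L) = 16 * A * α ^ 2 / L by ring, div_le_one hL0, hL]
    nlinarith
  set B : ℝ := t 1 * L with hB
  have ht1 : 0 ≤ t 1 := ht 1
  have hB0 : 0 ≤ B := by positivity
  -- the claim in `K, B` form
  suffices H : ∀ k, 1 ≤ k → t k ≤ K * B ^ k / (k : ℝ) ^ 2 by
    intro k hk
    have h := H k hk
    obtain ⟨n, rfl⟩ : ∃ n, k = n + 1 := ⟨k - 1, by omega⟩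
    calc t (n + 1) ≤ K * B ^ (n + 1) / ((n + 1 : ℕ) : ℝ) ^ 2 := h
      _ = t 1 * (t 1 * L) ^ (n + 1 - 1) / ((n + 1 : ℕ) : ℝ) ^ 2 := by
          rw [Nat.add_sub_cancel, hB, pow_succ]
          congr 1
          calc K * ((t 1 * L) ^ n * (t 1 * L)) = (K * L) * (t 1 * (t 1 * L) ^ n) := by ring
            _ = t 1 * (t 1 * L) ^ n := by rw [hKL, one_mul]
  intro k
  induction k using Nat.strong_induction_on with
  | _ k ih =>
  intro hk
  rcases Nat.lt_or_ge k 2 with hk1 | hk2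
  · obtain rfl : k = 1 := by omega
    have : K * B ^ 1 / ((1 : ℕ) : ℝ) ^ 2 = t 1 := by
      rw [hB, pow_one, Nat.cast_one, one_pow, div_one, show K * (t 1 * L) = (K * L) * t 1 by ring, hKL, one_mul]
    rw [this]
  · -- the weights `c i = K B^i / i²` dominate `t` strictly below `k`
    have hk' : (0 : ℝ) < k := by exact_mod_cast (show 0 < k by omega)
    set c : ℕ → ℝ := fun i => K * B ^ i / (i : ℝ) ^ 2 with hc
    have hcnn : ∀ i, 0 ≤ c i := fun i => by rw [hc]; positivity
    have hc0 : c 0 = 0 := by simp [hc]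
    have hct : ∀ i, i < k → 0 ≤ t i ∧ t i ≤ c i := by
      intro i hi
      refine ⟨ht i, ?_⟩
      rcases Nat.eq_zero_or_pos i with rfl | hi0
      · rw [ht0, hc0]
      · exact ih i hi hi0
    calc t k ≤ ∑ m ∈ Ico 2 (k + 1), a m * coeff k ((PowerSeries.mk t) ^ m) := hrec k hk2
      _ ≤ ∑ m ∈ Ico 2 (k + 1), a m * coeff k ((PowerSeries.mk c) ^ m) := by
          refine sum_le_sum fun m hm => mul_le_mul_of_nonneg_left ?_ (ha m)
          obtain ⟨n, rfl⟩ : ∃ n, m = n + 2 := ⟨m - 2, by rw [mem_Ico] at hm; omega⟩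
          exact coeff_pow_mono_top ht0 hc0 (ht k) (hcnn k) hct n
      _ ≤ ∑ m ∈ Ico 2 (k + 1), (A * α ^ m) * (K ^ m * B ^ k * 8 ^ (m - 1) / (k : ℝ) ^ 2) := by
          refine sum_le_sum fun m hm => ?_
          obtain ⟨n, rfl⟩ : ∃ n, m = n + 2 := ⟨m - 2, by rw [mem_Ico] at hm; omega⟩
          have hw := coeff_pow_weight_le hK0.le hB0 (n + 1) k hk
          have hnn : 0 ≤ coeff k ((PowerSeries.mk c) ^ (n + 2)) :=
            (coeff_pow_mono (t := c) (c := c) (j := k) (fun i _ => ⟨hcnn i, le_rfl⟩) (n + 2) k le_rfl).1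
          rw [show n + 2 - 1 = n + 1 by omega]
          exact mul_le_mul (haA _) hw hnn (by positivity)
      _ = (B ^ k / (k : ℝ) ^ 2) * (A * α * K) * ((8 * α * K) * ∑ j ∈ range (k + 1 - 2), (8 * α * K) ^ j) := by
          rw [sum_Ico_eq_sum_range, mul_sum, mul_sum]
          refine sum_congr rfl fun j _ => ?_
          rw [show 2 + j - 1 = j + 1 by omega]
          ring
      _ ≤ (B ^ k / (k : ℝ) ^ 2) * (A * α * K) * ((8 * α * K) * 2) := by
          have hgeom : ∑ j ∈ range (k + 1 - 2), (8 * α * K) ^ j ≤ 2 := by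
            have hg := geom_sum_mul_neg (8 * α * K) (k + 1 - 2)
            have hpow : 0 ≤ (8 * α * K) ^ (k + 1 - 2) := pow_nonneg hx0 _
            nlinarith [sum_nonneg (fun j (_ : j ∈ range (k + 1 - 2)) => pow_nonneg hx0 j)]
          gcongr
      _ = (K * B ^ k / (k : ℝ) ^ 2) * (16 * A * α ^ 2 * K) := by ring
      _ ≤ K * B ^ k / (k : ℝ) ^ 2 := mul_le_of_le_one_right (by positivity) hAK

/-- **Convergence of the packing series for an analytic nonlinearity**: under the hypotheses of
`analytic_majorant`, `Σ t k gᵏ` converges whenever `|g| · t 1 · (16α + 16Aα² + 1) < 1`. [folklore] -/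
theorem summable_of_analytic_majorant {t a : ℕ → ℝ} {A α : ℝ} (hA : 0 ≤ A) (hα : 0 ≤ α) (ht0 : t 0 = 0)
    (ht : ∀ k, 0 ≤ t k) (ha : ∀ m, 0 ≤ a m) (haA : ∀ m, a m ≤ A * α ^ m)
    (hrec : ∀ k, 2 ≤ k → t k ≤ ∑ m ∈ Finset.Ico 2 (k + 1), a m * PowerSeries.coeff k (PowerSeries.mk t ^ m))
    {g : ℝ} (hg : |g| * (t 1 * (16 * α + 16 * A * α ^ 2 + 1)) < 1) :
    Summable (fun k => t k * g ^ k) := by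
  have ht1 : 0 ≤ t 1 := ht 1
  set ρ : ℝ := t 1 * (16 * α + 16 * A * α ^ 2 + 1) with hρ
  have hρ0 : 0 ≤ ρ := by
    rw [hρ]; have : 0 ≤ 16 * α + 16 * A * α ^ 2 + 1 := by positivity
    positivity
  have hq0 : 0 ≤ |g| * ρ := by positivity
  have hmaj := analytic_majorant t a A α hA hα ht0 ht ha haA hrec
  rw [← summable_nat_add_iff 1]
  refine Summable.of_norm_bounded (g := fun k : ℕ => t 1 * |g| * (|g| * ρ) ^ k)
    ((summable_geometric_of_lt_one hq0 hg).mul_left _) fun k => ?_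
  rw [Real.norm_eq_abs, abs_mul, abs_of_nonneg (ht _), abs_pow]
  have hk1 : (1 : ℝ) ≤ ((k + 1 : ℕ) : ℝ) ^ 2 := by
    have : (1 : ℝ) ≤ ((k + 1 : ℕ) : ℝ) := by exact_mod_cast Nat.succ_pos k
    nlinarith
  have hb : t (k + 1) ≤ t 1 * ρ ^ k := by
    have h := hmaj (k + 1) (by omega)
    rw [Nat.add_sub_cancel] at h
    calc t (k + 1) ≤ t 1 * ρ ^ k / ((k + 1 : ℕ) : ℝ) ^ 2 := h
      _ ≤ t 1 * ρ ^ k := div_le_self (by positivity) hk1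
  calc t (k + 1) * |g| ^ (k + 1) ≤ t 1 * ρ ^ k * |g| ^ (k + 1) := by gcongr
    _ = t 1 * |g| * (|g| * ρ) ^ k := by ring

end Summit.AtomisticToContinuum.HydrodynamicLimit.Theorems.PackingAnalyticImplosion

end
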